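import Mathlib
import Summits.KontsevichZagierPeriods.Zeta5Search.ClassTypeGuards
import Summits.KontsevichZagierPeriods.Zeta5Search.Ray1Points
import HarnessLib

/-!
# ζ(5) search — CLASS TYPE COVERS for the T1-map ray C1: level regions and window wrappers of `bRay β1 n` (P1 g13)

HONEST FRAMING: systematic search; no irrationality claim unless certified.  Cell `pub-zeta5`, prover seat P1, generation 13.
Valuations of explicit rationals; every kernel exponent these feed stays `< 1` — no irrationality content; nothing about `ζ(5)`.

The ray-C1 counterpart of p3 g6's `RecordRayLevels` (§5 of the class-type-cover files `ClassTypeCover` / `ClassTypeGuards`,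
which are generic in `b`): for the T1-map ray C1 = census g8 #1, `b(n) = n·(85; 35,32,30,27,25,22,20)` = `T1Rays.bRay β1 n`
(`d = 64n`), this file supplies

* the parity flag of `b₀ = 85n` (`oddFlag_ray1`),
* the sixteen NET-EXPONENT REGIONS as level lemmas with ONE `omega`-checkable hypothesis each — `ne1_low` (`q < 20n`, value `1`),
  the lower staircase `ne1_d1 … ne1_d6` on `[20n,22n)`, `[22n,25n)`, `[25n,27n)`, `[27n,30n)`, `[30n,32n)`, `[32n,35n)` (values
  `0,…,−5`), the well `ne1_well` (`[35n,50n]` off the centre, `−6`), the even centre `ne1_cen` (`2q = 85n`, `−5`), the upper staircase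
  `ne1_u6 … ne1_u1` on `(50n,53n]`, `(53n,55n]`, `(55n,58n]`, `(58n,60n]`, `(60n,63n]`, `(63n,65n]` and `ne1_high` (`q > 65n`) — all from
  gen-2 g16's point kit `T1Rays.Ray1Points.pv_*`,
* the typed-class constructors `ray1Type_ne / ray1Type_eq` (`b₀ = 85n`), the window facts `ray1_window` (`p ≤ 64n = d`,
  `85n + 2 < p²`), THEOREM LB on the ray `ray1_LBthm`, and
* the WINDOW WRAPPERS `ray1_LB / ray1_J / ray1_B`: from a class-type cover of the residues, the decidable checks `checkLB` /
  `checkJ` / `checkB` (+ the fallback `checkLBx`) and the window facts, the bound `c ≤ v_p(Cas₇(b(n)))` by THEOREM LB / the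
  Lemma-D bonus / the double-drop bonus — verbatim the record-ray wrappers with `41n, 25n` replaced by `85n, 64n`.

Consumers: machine-generated per-window cover files for the LETTERS windows of census's C1 kernel ledger (law letters M / J / B),
each then one `atlasCert_` row of typer's `RayC1KernelAtlasWin*` via `RayKernel.cell_cert`.
-/

open Finset

namespace Summit.KontsevichZagierPeriods.Zeta5Search.ClassTypeCover

open Summit.KontsevichZagierPeriods.Zeta5Search.ClusterValuation
open Summit.KontsevichZagierPeriods.Zeta5Search.CasoratianValuation (InPolytope shift casoratian)
open Summit.KontsevichZagierPeriods.Zeta5Search.WedgeDictionary (dOf)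
open Summit.KontsevichZagierPeriods.Zeta5Search.T1Rays
open Summit.KontsevichZagierPeriods.Zeta5Search.T1Rays.Ray1Points

/-! ## §6 The T1-map ray C1 `b(n) = n·(85; 35,32,30,27,25,22,20)` -/

section RayC1

variable {n p q x : ℕ}

/-- The parity flag of `b₀ = 85n`. -/
theorem oddFlag_ray1 (n : ℕ) {r : ℕ} (hr : n % 2 = r) : decide (¬ (2 : ℤ) ∣ bRay β1 n 0) = decide (r = 1) := by
  rw [ray1_zero]
  have h2 : (2 : ℤ) ∣ ((85 * n : ℕ) : ℤ) ↔ n % 2 = 0 := by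
    constructor
    · intro h; omega
    · intro h; exact ⟨(85 * (n / 2) : ℕ), by push_cast; omega⟩
  by_cases h : n % 2 = 0
  · rw [decide_eq_decide]; constructor
    · intro hn; exact absurd (h2.2 h) hn
    · intro h1; omega
  · rw [decide_eq_decide]; constructor
    · intro _; omega
    · intro _ hd; exact h (h2.1 hd)

/-- Net exponent below the blocks: `q < 20n`. -/
theorem ne1_low (h : q < 20 * n) : netExp (bRay β1 n) q = 1 := pv_low h

/-- Net exponent on `[20n, 22n)`. -/
theorem ne1_d1 (h : 20 * n ≤ q ∧ q < 22 * n) : netExp (bRay β1 n) q = 0 := pv_lo1 h.1 h.2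

/-- Net exponent on `[22n, 25n)`. -/
theorem ne1_d2 (h : 22 * n ≤ q ∧ q < 25 * n) : netExp (bRay β1 n) q = -1 := pv_lo2 h.1 h.2

/-- Net exponent on `[25n, 27n)`. -/
theorem ne1_d3 (h : 25 * n ≤ q ∧ q < 27 * n) : netExp (bRay β1 n) q = -2 := pv_lo3 h.1 h.2

/-- Net exponent on `[27n, 30n)`. -/
theorem ne1_d4 (h : 27 * n ≤ q ∧ q < 30 * n) : netExp (bRay β1 n) q = -3 := pv_lo4 h.1 h.2

/-- Net exponent on `[30n, 32n)`. -/
theorem ne1_d5 (h : 30 * n ≤ q ∧ q < 32 * n) : netExp (bRay β1 n) q = -4 := pv_lo5 h.1 h.2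

/-- Net exponent on `[32n, 35n)`. -/
theorem ne1_d6 (h : 32 * n ≤ q ∧ q < 35 * n) : netExp (bRay β1 n) q = -5 := pv_lo6 h.1 h.2

/-- Net exponent in the well `[35n, 50n]` off the centre. -/
theorem ne1_well (h : 35 * n ≤ q ∧ q ≤ 50 * n ∧ 2 * q ≠ 85 * n) : netExp (bRay β1 n) q = -6 := pv_well h.1 h.2.1 h.2.2

/-- Net exponent at the (even) centre `2q = 85n`. -/
theorem ne1_cen (h : 2 * q = 85 * n) : netExp (bRay β1 n) q = -5 := pv_cen h

/-- Net exponent on `(50n, 53n]`. -/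
theorem ne1_u6 (h : 50 * n < q ∧ q ≤ 53 * n) : netExp (bRay β1 n) q = -5 := pv_up6 h.1 h.2

/-- Net exponent on `(53n, 55n]`. -/
theorem ne1_u5 (h : 53 * n < q ∧ q ≤ 55 * n) : netExp (bRay β1 n) q = -4 := pv_up5 h.1 h.2

/-- Net exponent on `(55n, 58n]`. -/
theorem ne1_u4 (h : 55 * n < q ∧ q ≤ 58 * n) : netExp (bRay β1 n) q = -3 := pv_up4 h.1 h.2

/-- Net exponent on `(58n, 60n]`. -/
theorem ne1_u3 (h : 58 * n < q ∧ q ≤ 60 * n) : netExp (bRay β1 n) q = -2 := pv_up3 h.1 h.2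

/-- Net exponent on `(60n, 63n]`. -/
theorem ne1_u2 (h : 60 * n < q ∧ q ≤ 63 * n) : netExp (bRay β1 n) q = -1 := pv_up2 h.1 h.2

/-- Net exponent on `(63n, 65n]`. -/
theorem ne1_u1 (h : 63 * n < q ∧ q ≤ 65 * n) : netExp (bRay β1 n) q = 0 := pv_up1 h.1 h.2

/-- Net exponent above the blocks: `q > 65n`. -/
theorem ne1_high (h : 65 * n < q) : netExp (bRay β1 n) q = 1 := pv_high h

variable [Fact p.Prime]

/-- Typed class on ray C1, not self-conjugate. -/
theorem ray1Type_ne (L : ℕ) {T : List ℤ} (hlen : T.length = L + 1) (hx : x < p) (hL : x + L * p ≤ 85 * n)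
    (hL' : 85 * n < x + L * p + p) (hlev : Levels (bRay β1 n) x p T) (hne : 2 * x + L * p ≠ 85 * n) :
    IsType (bRay β1 n) p x T false :=
  isType_of_ne (by rw [ray1_zero]; positivity) L hlen hx (by rw [b0_toNat]; exact hL)
    (by rw [b0_toNat]; exact hL') hlev (by rw [b0_toNat]; exact hne)

/-- Typed class on ray C1, self-conjugate. -/
theorem ray1Type_eq (L : ℕ) {T : List ℤ} (hlen : T.length = L + 1) (hx : x < p) (hL : x + L * p ≤ 85 * n)
    (hL' : 85 * n < x + L * p + p) (hlev : Levels (bRay β1 n) x p T) (heq : 2 * x + L * p = 85 * n) :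
    IsType (bRay β1 n) p x T true :=
  isType_of_eq (by rw [ray1_zero]; positivity) L hlen hx (by rw [b0_toNat]; exact hL)
    (by rw [b0_toNat]; exact hL') hlev (by rw [b0_toNat]; exact heq)

omit [Fact p.Prime] in
/-- The window facts of ray C1 (`d = 64n`). -/
theorem ray1_window (hpd : p ≤ 64 * n) (hsq : 85 * n + 2 < p ^ 2) :
    (p : ℤ) ≤ bRay β1 n 0 ∧ (p : ℤ) ≤ dOf (bRay β1 n) ∧ (bRay β1 n 0 + 2 : ℤ) < (p : ℤ) ^ 2 := by
  rw [ray1_zero, dOf_ray1]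
  refine ⟨by exact_mod_cast (show p ≤ 85 * n by omega), by exact_mod_cast hpd, by exact_mod_cast hsq⟩

omit [Fact p.Prime] in
/-- THEOREM LB on ray C1. -/
theorem ray1_LBthm (hn : 1 ≤ n) (hpr : p.Prime) (hp5 : 5 ≤ p) (hpd : p ≤ 64 * n) (hsq : 85 * n + 2 < p ^ 2)
    (hne : casoratian (bRay β1 n) 7 ≠ 0) : casLB (bRay β1 n) p ≤ padicValRat p (casoratian (bRay β1 n) 7) :=
  casoratianClassBound_holds (bRay β1 n) 7 p (inPolytope_ray1 n) (by norm_num) (by norm_num)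
    (inPolytope_shift_ray1 hn) hpr hp5 (ray1_window hpd hsq).2.2 hne

omit [Fact p.Prime] in
/-- **RAY-C1 WINDOW BOUND by THEOREM LB**: `c ≤ v_p(Cas₇(b(n)))` from a cover and `checkLB` at `A + B ≥ c` (`c ≤ 0`). -/
theorem ray1_LB (hn : 1 ≤ n) (hpr : p.Prime) (hp5 : 5 ≤ p) (hpd : p ≤ 64 * n) (hsq : 85 * n + 2 < p ^ 2)
    {r : ℕ} (hr : n % 2 = r) {TY : List (List ℤ × Bool)} (hcov : Cover (bRay β1 n) p TY) {A B c : ℤ}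
    (hLB : checkLB (decide (r = 1)) TY A B = true) (hB1 : B ≤ 1) (hc : c ≤ A + B) (hc0 : c ≤ 0)
    (hne : casoratian (bRay β1 n) 7 ≠ 0) : c ≤ padicValRat p (casoratian (bRay β1 n) 7) := by
  haveI : Fact p.Prime := ⟨hpr⟩
  obtain ⟨-, hpd', -⟩ := ray1_window (n := n) hpd hsq
  have hv := ray1_LBthm hn hpr hp5 hpd hsq hne
  rcases casLB_ge_of_cover hcov (by rw [oddFlag_ray1 n hr]; exact hLB) hB1 hpd' with h0 | h
  · rw [h0] at hv; exact le_trans (by exact_mod_cast hc0) hv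
  · linarith

omit [Fact p.Prime] in
/-- **RAY-C1 WINDOW BOUND by the LEMMA-D BONUS**: `c ≤ v_p(Cas₇(b(n)))` from a cover, `checkLB` at `(m, B)` with
`c ≤ m + B + 1`, `checkJ` at `m`, and the fallback `checkLBx` at `(m; A', B')` with `c ≤ A' + B'` for the lattice points where
no multipole class attains `m`. -/
theorem ray1_J (hn : 1 ≤ n) (hpr : p.Prime) (hp5 : 5 ≤ p) (hpd : p ≤ 64 * n) (hsq : 85 * n + 2 < p ^ 2)
    {r : ℕ} (hr : n % 2 = r) {TY : List (List ℤ × Bool)} (hcov : Cover (bRay β1 n) p TY) {m B A' B' c : ℤ}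
    (hLB : checkLB (decide (r = 1)) TY m B = true) (hB1 : B ≤ 1)
    (hJ : checkJ (decide (r = 1)) TY m = true)
    (hLBx : checkLBx (decide (r = 1)) TY m A' B' = true) (hB1' : B' ≤ 1)
    (hc : c ≤ m + B + 1) (hc' : c ≤ A' + B') (hc0 : c ≤ 0)
    (hne : casoratian (bRay β1 n) 7 ≠ 0) : c ≤ padicValRat p (casoratian (bRay β1 n) 7) := by
  haveI : Fact p.Prime := ⟨hpr⟩
  obtain ⟨hpb, hpd', hwin⟩ := ray1_window (n := n) hpd hsq
  have hv := ray1_LBthm hn hpr hp5 hpd hsq hne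
  by_cases hreal : ∃ x, x < p ∧ 2 ≤ classPoleCount (bRay β1 n) p x ∧ classExp (bRay β1 n) p x = m
  · have hJ' := lemmaD_of_cover (inPolytope_ray1 n) (by norm_num) (by norm_num) (inPolytope_shift_ray1 hn) hpr hp5 hpb hpd'
      hwin hcov (by rw [oddFlag_ray1 n hr]; exact hJ) hreal hne
    rcases casLB_ge_of_cover hcov (by rw [oddFlag_ray1 n hr]; exact hLB) hB1 hpd' with h0 | h
    · rw [h0] at hv; exact le_trans (by exact_mod_cast hc0) hv
    · linarith
  · rcases casLB_ge_of_cover_x hcov (by rw [oddFlag_ray1 n hr]; exact hLBx) hB1' hpd' hreal with h0 | h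
    · rw [h0] at hv; exact le_trans (by exact_mod_cast hc0) hv
    · linarith

omit [Fact p.Prime] in
/-- **RAY-C1 WINDOW BOUND by the DOUBLE-DROP BONUS**: `c ≤ v_p(Cas₇(b(n)))` from a cover, `checkLB` at `(−N, B)` with
`c ≤ −N + B + 2`, `checkB` at `N` (`N ≥ 3` even), and the fallback `checkLBx` at `(−N; A', B')` with `c ≤ A' + B'`. -/
theorem ray1_B (hn : 1 ≤ n) (hpr : p.Prime) (hp5 : 5 ≤ p) (hpd : p ≤ 64 * n) (hsq : 85 * n + 2 < p ^ 2)
    {r : ℕ} (hr : n % 2 = r) {TY : List (List ℤ × Bool)} (hcov : Cover (bRay β1 n) p TY) {N : ℕ} (hN : 3 ≤ N)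
    (hNe : Even N) {B A' B' c : ℤ}
    (hLB : checkLB (decide (r = 1)) TY (-(N : ℤ)) B = true) (hB1 : B ≤ 1)
    (hB : checkB (decide (r = 1)) TY N = true)
    (hLBx : checkLBx (decide (r = 1)) TY (-(N : ℤ)) A' B' = true) (hB1' : B' ≤ 1)
    (hc : c ≤ -(N : ℤ) + B + 2) (hc' : c ≤ A' + B') (hc0 : c ≤ 0)
    (hne : casoratian (bRay β1 n) 7 ≠ 0) : c ≤ padicValRat p (casoratian (bRay β1 n) 7) := by
  haveI : Fact p.Prime := ⟨hpr⟩
  obtain ⟨hpb, hpd', hwin⟩ := ray1_window (n := n) hpd hsq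
  have hv := ray1_LBthm hn hpr hp5 hpd hsq hne
  by_cases hreal : ∃ x, x < p ∧ 2 ≤ classPoleCount (bRay β1 n) p x ∧ classExp (bRay β1 n) p x = -(N : ℤ)
  · have hB' := doubleDrop_of_cover (inPolytope_ray1 n) (by norm_num) (by norm_num) (inPolytope_shift_ray1 hn) hpr hp5 hpb hpd'
      hwin hcov hN hNe (by rw [oddFlag_ray1 n hr]; exact hB) hreal hne
    rcases casLB_ge_of_cover hcov (by rw [oddFlag_ray1 n hr]; exact hLB) hB1 hpd' with h0 | h
    · rw [h0] at hv; exact le_trans (by exact_mod_cast hc0) hv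
    · linarith
  · rcases casLB_ge_of_cover_x hcov (by rw [oddFlag_ray1 n hr]; exact hLBx) hB1' hpd' hreal with h0 | h
    · rw [h0] at hv; exact le_trans (by exact_mod_cast hc0) hv
    · linarith

end RayC1

end Summit.KontsevichZagierPeriods.Zeta5Search.ClassTypeCover
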